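import Summits.ResolutionOfSingularities.ResolutionOfSingularities.Theorems.MaxContactCutPort2
import Summits.ResolutionOfSingularities.ResolutionOfSingularities.Theorems.MaxContactCutExitCut
import HarnessLib

/-!
# MaxContactCutPortCut — decomp-res node «PortCut» (lens-2 g28, critic row 219 CLEARED · MAP +1 ONCE (D1: the
multi-unit port proved for every n)), tree file 5/5 of the node

Content VERBATIM from the decomp-res lens-2 g28 node `HOME/decomp-res-lens-2/g28/PortCut.lean` (pin 67bf9bb7; no
carry, imports the landed g27 node «ExitCut» + Literature; ns `…Theses.PortCut` ↦ `…Theorems.PortCut`); HOME =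
run/shared/lean/pub/decomp-res; critic CRITIC-LEDGER row 219 CLEARED · MAP +1 ONCE (D1): `componentPackagePort_holds
: ∀ n, ComponentPackagePort n` in kernel via `multiUnitPackageTransport_holds`; landing orders LANDING NOTE :1549 +
rider 12:16:46Z — provenance and critic text in full (and the lens header verbatim) in `ExitCutTransport`.  `--kind
proof --supports stmt-ResolutionOfSingularities-29273`.

## This file

`section Corollaries` — THE BY-NAME COROLLARIES through the LANDED g27 wirings with the port binder `hP : ∀ n ≥ 2,
ComponentPackagePort n` REMOVED (Theses cone), in lens order: `cuspGenericRung_of_engines` · `closes_of_engines`;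
`closes` cited from `CuspX.closes` (module comment).

[WRITER NOTE (decomp-res writer g13): file split only (tree files ≤ 400 lines); sections, section `variable`s /
`open`s and every declaration exactly as in the lens (namespace renamed Theses ↦ Theorems, the HOME-only
dupNamespace-linter line dropped; `noncomputable section` and the five file-level `open` lines replayed in every
file). Audit-cone caveat of the lens honoured: each pattern-matching recursive helper
(`isRegular_top_of_weakAdmissible`, `stalkIdeal_transformMarked_of_not_mem`, `WeakAdmissible.restrict`) stays in the
same file as a tactic-style proof referencing it whenever the cap allows; a cut between them changes nothing for the kernel.]

(Sources: Hironaka1964 Ch. III §§1–3, §7; Giraud1975; CossartJannsenSaito2020 Ch. 2, Ch. 8–9; EGAIV4 §16–§17;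
Matsumura1987 §28–§30; CossartPiltant2008 Prop. 4.2; BierstoneMilman1997 §3; Cutkosky2004 Ch. 6–7; Kollar2007 §3;
StacksProject 01WV / 0806 / 080A.)
-/

noncomputable section

open CategoryTheory AlgebraicGeometry IsLocalRing TopologicalSpace Topology
open Literature.AlgebraicGeometry.Resolution
open Summit.ResolutionOfSingularities.ResolutionOfSingularities.Theorems
open Summit.ResolutionOfSingularities.ResolutionOfSingularities.Theorems.WeakOrderReduction
open Summit.ResolutionOfSingularities.ResolutionOfSingularities.Theorems.FaceFormCutClasses

namespace Summit.ResolutionOfSingularities.ResolutionOfSingularities.Theorems.PortCut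

section Corollaries

open Summit.ResolutionOfSingularities.ResolutionOfSingularities.Theorems.DeltaFaceCutClasses
open Summit.ResolutionOfSingularities.ResolutionOfSingularities.Theorems.RelativeDeltaCut
open Summit.ResolutionOfSingularities.ResolutionOfSingularities.Theorems.CurveLeafExit
open Summit.ResolutionOfSingularities.ResolutionOfSingularities.Theorems.PinchCut
open Summit.ResolutionOfSingularities.ResolutionOfSingularities.Theorems.JetCut
open Summit.ResolutionOfSingularities.ResolutionOfSingularities.Theorems.PurityCut
open Summit.ResolutionOfSingularities.ResolutionOfSingularities.Theorems.SplitCut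
open Summit.ResolutionOfSingularities.ResolutionOfSingularities.Theorems.CylinderCut
open Summit.ResolutionOfSingularities.ResolutionOfSingularities.Theorems.SpreadCut
open Summit.ResolutionOfSingularities.ResolutionOfSingularities.Theorems.CrossCut
open Summit.ResolutionOfSingularities.ResolutionOfSingularities.Theorems.DeepCrossCut
open Summit.ResolutionOfSingularities.ResolutionOfSingularities.Theorems.OddCrossCut
open Summit.ResolutionOfSingularities.ResolutionOfSingularities.Theorems.CuspCut
open Summit.ResolutionOfSingularities.ResolutionOfSingularities.Theses

/-- **`CuspX.CuspGenericRung` FROM THE EIGHTEEN ENGINES ALONE** — the landed wiring `ExitCut.cuspGenericRung_of_ports`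
(= `CuspX.cuspGenericRung_of_ports` with `h1 : OrderOneContact` discharged, g27) with its LAST port binder
`hP : ∀ n ≥ 2, ComponentPackagePort n` DISCHARGED by the kernel `componentPackagePort_holds'`. [folklore] -/
theorem cuspGenericRung_of_engines (hV : VeryNearCutClasses.VeryNearExit) (hD : DeltaPackageExit)
    (hU : UniformCurvePackageExit) (hR : RelCurvePackageExit) (hN : NormalConeJumpExit)
    (hM : MonomialPinchExit) (hC : FlatConeExit) (hGE : GrandExit) (hSE : SplitConeExit)
    (hJE : JetCylinderExit) (hX : MaxContactCut.MaxOrderThreefoldResolution) (hΓE : SpreadExit) (hXE : CrossExit)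
    (hDXE : DeepCrossExit) (hNE : NodeExit) (hOXE : OddCrossExit) (hCuE : CuspExit) (hTaE : TameTwoExit) :
    CuspX.CuspGenericRung :=
  ExitCut.cuspGenericRung_of_ports hV hD hU hR hN hM hC hGE hSE hJE hX hΓE hXE hDXE hNE hOXE hCuE hTaE
    componentPackagePort_holds'

/-- **`MaxContactCut.RungOne` BY NAME from the eighteen engines and the located residual `CuspX.CuspSpecialRung`**
(= the landed `ExitCut.closes_of_engines … componentPackagePort_holds' hS`: its port binder `hP` discharged). [folklore] -/
theorem closes_of_engines (hV : VeryNearCutClasses.VeryNearExit) (hD : DeltaPackageExit)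
    (hU : UniformCurvePackageExit) (hR : RelCurvePackageExit) (hN : NormalConeJumpExit)
    (hM : MonomialPinchExit) (hC : FlatConeExit) (hGE : GrandExit) (hSE : SplitConeExit)
    (hJE : JetCylinderExit) (hX : MaxContactCut.MaxOrderThreefoldResolution) (hΓE : SpreadExit) (hXE : CrossExit)
    (hDXE : DeepCrossExit) (hNE : NodeExit) (hOXE : OddCrossExit) (hCuE : CuspExit) (hTaE : TameTwoExit)
    (hS : CuspX.CuspSpecialRung) : MaxContactCut.RungOne :=
  CuspX.closes (cuspGenericRung_of_engines hV hD hU hR hN hM hC hGE hSE hJE hX hΓE hXE hDXE hNE hOXE hCuE hTaE) hS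

/-! ### `closes` — NOT re-landed here (gate dedup: the statement is already a landed theorem)

The node's `theorem closes (hG : CuspX.CuspGenericRung) (hS : CuspX.CuspSpecialRung) : MaxContactCut.RungOne` (proof
`CuspX.closes hG hS`) has exactly the type of the LANDED `CuspCut.CuspX.closes` (`Theorems/MaxContactCutCuspCut.lean`) and of
`FaceCut.FaceX.closes` (`Theorems/MaxContactCutFaceCut.lean`) — the same citation as for g27 «ExitCut»
(`Theorems/MaxContactCutExitCut.lean`);
the gate's dedup lint refuses a restatement, so the column target BY NAME is CITED from those declarations (located
halves unchanged:
`CuspX.CuspGenericRung` [DECIDED MOD exactly the eighteen engine letters — BOTH port binders are now theorems: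
`ExitCut.oneShotPort_holds` (g27)
and `componentPackagePort_holds'` (this node), see `cuspGenericRung_of_engines` / `closes_of_engines` above] and
`CuspX.CuspSpecialRung` [UNDECIDED]). Writer g13. -/

end Corollaries

end Summit.ResolutionOfSingularities.ResolutionOfSingularities.Theorems.PortCut
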